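import Summits.Ventures.PercRepro.Night2LocalD2R14Large

/-!
# PercRepro — the large shadow sets of the coloop cell: counting the pair preimages (night-2, gen 16)

At a shadow set `S` with `|S| ≥ 7` of the coloop cell (Night2LocalD2R14Large), the degree bound
`card_pairPre_filter_mem_le_two` gives the counts the column bound of R1₄ needs (proofs/NIGHT-2-k1.md §6):

* **`card_pairPre_add_one_le_card`**: `#pairPre ≤ |S| − 1` (double counting over the points of `S ∖ {y}`);
* **`not_sdiff_subset_clF_of_far`** / **`card_pairPre_le_three_of_far`**: a far preimage `B₀` (`|G ∖ cl B₀| = 2`)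
  meets every pair set (else `G ∖ B ⊆ (cl B₀) ∖ {y}` of rank `3` would give `ρ(E ∖ B) ≤ 5`), so with a far preimage
  there are at most `3` pair preimages;
* the covering preimages are treated in Night2LocalD2R14LargeCoColoop.
-/

namespace PercRepro.Shadow

open Finset PerFlat ThmH

variable {α : Type*} [DecidableEq α] {M : Matroid α} [M.Finite]

/-! ## Double counting -/

open scoped Classical in
/-- **`#pairPre ≤ |S| − 1`** at a shadow set with `|S| ≥ 7` of the coloop cell (simple matroid). -/
theorem card_pairPre_add_one_le_card {G : Finset α} (hG : G ∈ flatsQ M (4 + 1))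
    (hsimple : ∀ e ∈ gr M, ∀ f ∈ gr M, e ≠ f → rkN M {e, f} = 2) {y : α} (hyG : y ∈ G)
    (hyc : y ∉ clF M (G.erase y)) {S : Finset α} (hS : S ∈ shadowAt M (4 + 2) 4 (Uq M (4 + 2) 4) G)
    (h7 : 7 ≤ S.card) : (pairPre M 4 G S).card + 1 ≤ S.card := by
  have hyS : y ∈ S := mem_of_mem_shadowAt_of_coloop (by rw [rkN_erase_eq_of_coloop hG hyG hyc]) hS
  have hdc := Finset.sum_card_bipartiteAbove_eq_sum_card_bipartiteBelow (fun b B => b ∈ S \ B) (s := S)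
    (t := pairPre M 4 G S)
  have hR : ∀ B ∈ pairPre M 4 G S, (Finset.bipartiteBelow (fun b B => b ∈ S \ B) S B).card = 2 := by
    intro B hB
    have : Finset.bipartiteBelow (fun b B => b ∈ S \ B) S B = S \ B := by
      ext e
      rw [Finset.mem_bipartiteBelow, Finset.mem_sdiff]
      tauto
    rw [this, card_sdiff_of_mem_pairPre hB]
  rw [Finset.sum_congr rfl hR, Finset.sum_const, smul_eq_mul] at hdc
  have hL : ∑ b ∈ S, (Finset.bipartiteAbove (fun b B => b ∈ S \ B) (pairPre M 4 G S) b).card ≤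
      2 * (S.card - 1) := by
    rw [← Finset.add_sum_erase S _ hyS]
    have h0 : (Finset.bipartiteAbove (fun b B => b ∈ S \ B) (pairPre M 4 G S) y).card = 0 := by
      rw [Finset.card_eq_zero, Finset.eq_empty_iff_forall_notMem]
      intro B hB
      rw [Finset.mem_bipartiteAbove] at hB
      exact (Finset.mem_sdiff.1 hB.2).2 (mem_of_mem_pairPre hG hyG hyc hB.1)
    rw [h0, zero_add]
    calc ∑ b ∈ S.erase y, (Finset.bipartiteAbove (fun b B => b ∈ S \ B) (pairPre M 4 G S) b).card
        ≤ ∑ _b ∈ S.erase y, 2 := by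
          apply Finset.sum_le_sum
          intro b _
          exact card_pairPre_filter_mem_le_two hG hsimple hyG hyc hS h7 b
      _ = 2 * (S.card - 1) := by
          rw [Finset.sum_const, smul_eq_mul, Finset.card_erase_of_mem hyS, mul_comm]
  omega

/-! ## A far preimage meets every pair set -/

open scoped Classical in
/-- The coloop `y` lies in every far preimage. -/
theorem mem_of_mem_opFarPre {G : Finset α} (hG : G ∈ flatsQ M (4 + 1)) {y : α} (hyG : y ∈ G)
    (hyc : y ∉ clF M (G.erase y)) {S B : Finset α} (hB : B ∈ opFarPre M G S) : y ∈ B :=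
  mem_of_two_le_card_sdiff_clF hG hyG hyc (mem_opFarPre.1 hB).1 (by rw [(mem_opFarPre.1 hB).2.1])

open scoped Classical in
/-- `cl B₀ ∖ {y}` has rank `3` for a member `B₀` containing the coloop `y`. -/
theorem rkN_clF_erase_eq_three {G : Finset α} (hG : G ∈ flatsQ M (4 + 1)) {y : α} (hyG : y ∈ G)
    (hyc : y ∉ clF M (G.erase y)) {B₀ : Finset α} (hB₀ : B₀ ∈ membersIn M (Uq M (4 + 2) 4) G) (hyB : y ∈ B₀) :
    rkN M ((clF M B₀).erase y) = 3 := by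
  have hGg : G ⊆ gr M := (mem_flatsQ.1 hG).1
  have hU := (mem_membersIn.1 hB₀).1
  have hclG : clF M B₀ ⊆ G := (mem_membersIn.1 hB₀).2
  have hsub : (clF M B₀).erase y ⊆ G.erase y := Finset.erase_subset_erase _ hclG
  have hycl : y ∉ clF M ((clF M B₀).erase y) := fun h => hyc (clF_mono hsub h)
  have h1 := rkN_insert_eq_add_one_of_notMem_clF (M := M) (hsub.trans ((Finset.erase_subset _ _).trans hGg))
    (hGg hyG) hycl
  rw [Finset.insert_erase (subset_clF hU hyB), rkN_clF_eq_of_mem_Uq hU] at h1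
  omega

open scoped Classical in
/-- **A far preimage meets every pair set**: the pair set `S ∖ B` of a pair preimage is not inside `cl B₀`. -/
theorem not_sdiff_subset_clF_of_far {G : Finset α} (hG : G ∈ flatsQ M (4 + 1)) (hd : (gr M \ G).card = 2)
    {y : α} (hyG : y ∈ G) (hyc : y ∉ clF M (G.erase y)) {S B₀ B : Finset α} (h₀ : B₀ ∈ opFarPre M G S)
    (hB : B ∈ pairPre M 4 G S) : ¬ S \ B ⊆ clF M B₀ := by
  intro hcon
  have hGg : G ⊆ gr M := (mem_flatsQ.1 hG).1
  have hBm := (mem_pairPre.1 hB).1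
  have hU : B ∈ Uq M (4 + 2) 4 := (mem_membersIn.1 hBm).1
  have hyB := mem_of_mem_pairPre hG hyG hyc hB
  have hy₀ := mem_of_mem_opFarPre hG hyG hyc h₀
  have hGS := sdiff_subset_clF_of_mem_opFarPre h₀
  -- `G ∖ B ⊆ cl B₀ ∖ {y}`
  have h1 : G \ B ⊆ (clF M B₀).erase y := by
    intro e he
    rw [Finset.mem_sdiff] at he
    rw [Finset.mem_erase]
    refine ⟨fun h => he.2 (h ▸ hyB), ?_⟩
    by_cases heS : e ∈ S
    · exact hcon (Finset.mem_sdiff.2 ⟨heS, he.2⟩)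
    · exact hGS (Finset.mem_sdiff.2 ⟨he.1, heS⟩)
  have h2 : rkN M (G \ B) ≤ 3 := by
    have := rkN_mono (M := M) h1
    rw [rkN_clF_erase_eq_three hG hyG hyc (mem_opFarPre.1 h₀).1 hy₀] at this
    exact this
  -- `E ∖ B ⊆ (G ∖ B) ∪ (E ∖ G)`
  have h3 : gr M \ B ⊆ (G \ B) ∪ (gr M \ G) := by
    intro e he
    rw [Finset.mem_sdiff] at he
    rw [Finset.mem_union, Finset.mem_sdiff, Finset.mem_sdiff]
    by_cases heG : e ∈ G
    · left; exact ⟨heG, he.2⟩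
    · right; exact ⟨he.1, heG⟩
  have h4 := rkN_mono (M := M) h3
  have h5 := rkN_union_le_rkN_add_card (M := M) (G \ B) (gr M \ G)
  have h6 := rkN_sdiff_eq_of_mem_Uq hU
  omega

open scoped Classical in
/-- **With a far preimage there are at most three pair preimages** (`|S| ≥ 7`, simple). -/
theorem card_pairPre_le_three_of_far {G : Finset α} (hG : G ∈ flatsQ M (4 + 1)) (hd : (gr M \ G).card = 2)
    (hsimple : ∀ e ∈ gr M, ∀ f ∈ gr M, e ≠ f → rkN M {e, f} = 2) {y : α} (hyG : y ∈ G)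
    (hyc : y ∉ clF M (G.erase y)) {S : Finset α} (hS : S ∈ shadowAt M (4 + 2) 4 (Uq M (4 + 2) 4) G)
    (h7 : 7 ≤ S.card) {B₀ : Finset α} (h₀ : B₀ ∈ opFarPre M G S) : (pairPre M 4 G S).card ≤ 3 := by
  have hSG : S ⊆ G := subset_of_mem_shadowAt hS
  have hX₀ : S \ B₀ = G \ clF M B₀ := sdiff_eq_of_mem_opFarPre h₀
  have hc₀ : (S \ B₀).card = 2 := by rw [hX₀]; exact (mem_opFarPre.1 h₀).2.1
  obtain ⟨a, b, hab, hXab⟩ := Finset.card_eq_two.1 hc₀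
  have hp₀ : B₀ ∈ pairPre M 4 G S := opFarPre_subset_pairPre G S h₀
  -- every pair preimage lies in one of the two fibres
  have hcover : pairPre M 4 G S ⊆ (pairPre M 4 G S).filter (fun B => a ∈ S \ B) ∪
      (pairPre M 4 G S).filter (fun B => b ∈ S \ B) := by
    intro B hB
    have hne := not_sdiff_subset_clF_of_far hG hd hyG hyc h₀ hB
    rw [Finset.not_subset] at hne
    obtain ⟨e, heX, hecl⟩ := hne
    have heX₀ : e ∈ S \ B₀ := by
      rw [hX₀, Finset.mem_sdiff]
      exact ⟨hSG (Finset.mem_sdiff.1 heX).1, hecl⟩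
    rw [hXab, Finset.mem_insert, Finset.mem_singleton] at heX₀
    rw [Finset.mem_union, Finset.mem_filter, Finset.mem_filter]
    rcases heX₀ with rfl | rfl
    · left; exact ⟨hB, heX⟩
    · right; exact ⟨hB, heX⟩
  have ha := card_pairPre_filter_mem_le_two hG hsimple hyG hyc hS h7 a
  have hb := card_pairPre_filter_mem_le_two hG hsimple hyG hyc hS h7 b
  have hinter : 1 ≤ ((pairPre M 4 G S).filter (fun B => a ∈ S \ B) ∩
      (pairPre M 4 G S).filter (fun B => b ∈ S \ B)).card := by
    apply Finset.card_pos.2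
    refine ⟨B₀, ?_⟩
    rw [Finset.mem_inter, Finset.mem_filter, Finset.mem_filter, hXab]
    simp only [Finset.mem_insert, Finset.mem_singleton, true_or, or_true, and_self, hp₀]
  have hu := Finset.card_union_add_card_inter ((pairPre M 4 G S).filter (fun B => a ∈ S \ B))
    ((pairPre M 4 G S).filter (fun B => b ∈ S \ B))
  have hle := Finset.card_le_card hcover
  omega

end PercRepro.Shadow
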